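import Mathlib
import Literature.NumberTheory.Transcendental.ZagierDilogarithmConjecture
import Literature.NumberTheory.Transcendental.PreBlochGroup
import Literature.NumberTheory.Transcendental.PreBlochPlaces
import Literature.NumberTheory.Transcendental.PreBlochRogersProofs
import Summits.KontsevichZagierPeriods.KontsevichZagierPeriods.Theorems.HyperbolicBlochZagierDilogarithmConjectureStubTwoSaturation
import HarnessLib

/-!
# `ZagierDilogarithmConjecture` (stmt-KontsevichZagierPeriods-10550) — line
`kummer-clausen-linearisation` (reshape c2), stub `stub_distributionSlice`

**The distribution slice of Zagier's dilogarithm conjecture holds UNCONDITIONALLY.** For `N ≥ 1`,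
`ζ = e^{2πi/N}` and algebraic `x`, the formal distribution combination
`[xᴺ] − N · Σ_{m<N} [ζᵐ x] ∈ ℤ[ℂ]` lies in the dilogarithm relator group `⟨dilogRelators⟩` — so the
weight-2 distribution relations `D(xᴺ) = N Σ D(ζᵐ x)` among Bloch–Wigner values at algebraic points are
explained by five-term relations over `ℚ̄` (plus the flat relators `[0]`, `[1]` where an argument
degenerates), with no appeal to Borel's theorem. Source of the algebra: Dupont's identity
`{zᴺ} = N Σ_{j<N} {ζʲ z}` in the pre-Bloch group `𝒫(F)` of an algebraically closed field of
characteristic `0` (Dupont 2001 Cor. 8.15, from Rogers' identity Thm. 8.14; tree `PreBloch.distribution'`),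
applied in `𝒫(ℚ̄)` (`ℚ̄ = algebraicClosure ℚ ℂ`) and pushed forward along `ℤ⟨ℚ̄ ∖ {0,1}⟩ → ℤ[ℂ]`
(`closure_fiveTerm_le_comap`). Sorry-free; axioms ⊆ {propext, Classical.choice, Quot.sound}.
-/

noncomputable section

open scoped BigOperators ComplexConjugate
open Literature.NumberTheory.Transcendental
open FreeAbelianGroup (of lift_apply_of)

namespace Summit.KontsevichZagierPeriods.HyperbolicBloch.ZagierDilogarithmGaloisDescent

open Summit.KontsevichZagierPeriods.HyperbolicBloch.ZagierDilogarithm (closure_fiveTerm_le_comap)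

section lift

variable {Q : IntermediateField ℚ ℂ}

/-- A set-theoretic lift of the extended symbol: `⟨z⟩ = [z]` for `z ∉ {0,1}` and `0` otherwise, in the
free abelian group on `Q ∖ {0,1}`. [folklore] -/
theorem distrib_exists_symLift :
    ∃ s : Q → FreeAbelianGroup (PreBloch.Gen Q),
      (∀ (z : Q) (h : z ≠ 0 ∧ z ≠ 1), s z = of (⟨z, h⟩ : PreBloch.Gen Q)) ∧
      (∀ z : Q, ¬(z ≠ 0 ∧ z ≠ 1) → s z = 0) := by
  classical
  exact ⟨fun z => if h : z ≠ 0 ∧ z ≠ 1 then of (⟨z, h⟩ : PreBloch.Gen Q) else 0,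
    fun z h => dif_pos h, fun z h => dif_neg h⟩

/-- The lift projects to the extended symbol `PreBloch.sym`. [folklore] -/
theorem distrib_proj_symLift {s : Q → FreeAbelianGroup (PreBloch.Gen Q)}
    (hs : ∀ (z : Q) (h : z ≠ 0 ∧ z ≠ 1), s z = of (⟨z, h⟩ : PreBloch.Gen Q))
    (hs' : ∀ z : Q, ¬(z ≠ 0 ∧ z ≠ 1) → s z = 0)
    (z : Q) : PreBloch.proj (s z) = PreBloch.sym z := by
  by_cases h : z ≠ 0 ∧ z ≠ 1
  · rw [hs z h, PreBloch.sym_of_ne h]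
    rfl
  · rw [hs' z h, PreBloch.sym_of_not h, map_zero]

/-- Pushing the lift forward to `ℤ[ℂ]`: `ι ⟨z⟩ ≡ [z]` modulo the real relators `[0]`, `[1]`. [folklore] -/
theorem distrib_iota_symLift_sub_mem {s : Q → FreeAbelianGroup (PreBloch.Gen Q)}
    (hs : ∀ (z : Q) (h : z ≠ 0 ∧ z ≠ 1), s z = of (⟨z, h⟩ : PreBloch.Gen Q))
    (hs' : ∀ z : Q, ¬(z ≠ 0 ∧ z ≠ 1) → s z = 0)
    (ι : FreeAbelianGroup (PreBloch.Gen Q) →+ FreeAbelianGroup ℂ)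
    (hι : ∀ g, ι (of g) = of (g.val : ℂ)) (z : Q) :
    of (z : ℂ) - ι (s z) ∈ AddSubgroup.closure dilogRelators := by
  by_cases h : z ≠ 0 ∧ z ≠ 1
  · have e : ι (s z) = of (z : ℂ) := by
      rw [hs z h]
      exact hι ⟨z, h⟩
    rw [e, sub_self]
    exact zero_mem _
  · rw [hs' z h, map_zero, sub_zero]
    refine AddSubgroup.subset_closure (of_real_mem_dilogRelators ?_)
    rcases not_and_or.1 h with h0 | h1
    · rw [not_not.1 h0]; simp
    · rw [not_not.1 h1]; simp

end lift

/-- **The distribution slice (unconditional)** (stub `stub_distributionSlice` of line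
`kummer-clausen-linearisation`): for `N ≥ 1`, `ζ = e^{2πi/N}` and algebraic `x ∈ ℂ`,
`[xᴺ] − N · Σ_{m<N} [ζᵐ x] ∈ ⟨dilogRelators⟩`. [cite: Dupont2001, Cor. 8.15] -/
theorem stub_distributionSlice :
    ∀ (N : ℕ), 0 < N → ∀ (x : ℂ), IsAlgebraic ℚ x →
      (FreeAbelianGroup.of (x ^ N) -
        N • ∑ m ∈ Finset.range N,
          FreeAbelianGroup.of (Complex.exp (2 * Real.pi * Complex.I / N) ^ m * x)) ∈
        AddSubgroup.closure dilogRelators := by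
  classical
  intro N hN x hx
  -- the field of algebraic numbers `Q = ℚ̄ ⊂ ℂ`, algebraically closed of characteristic zero
  set Q : IntermediateField ℚ ℂ := algebraicClosure ℚ ℂ with hQdef
  haveI : IsAlgClosure ℚ Q := algebraicClosure.isAlgClosure ℚ ℂ
  haveI : IsAlgClosed Q := IsAlgClosure.isAlgClosed ℚ
  have hQ : ∀ z, z ∈ Q ↔ IsAlgebraic ℚ z := fun _ => mem_algebraicClosure_iff
  -- the primitive root and the point, in `Q`
  set ζ : ℂ := Complex.exp (2 * Real.pi * Complex.I / N) with hζdef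
  have hζ : IsPrimitiveRoot ζ N := Complex.isPrimitiveRoot_exp N hN.ne'
  have hζalg : IsAlgebraic ℚ ζ := by
    refine ⟨Polynomial.X ^ N - 1, Polynomial.X_pow_sub_C_ne_zero hN 1, ?_⟩
    simp [hζ.pow_eq_one]
  let Z : Q := ⟨ζ, (hQ _).2 hζalg⟩
  let X : Q := ⟨x, (hQ _).2 hx⟩
  have hZ' : IsPrimitiveRoot ((algebraMap Q ℂ : Q →+* ℂ) Z) N := hζ
  have hZ : IsPrimitiveRoot Z N :=
    IsPrimitiveRoot.of_map_of_injective hZ' (FaithfulSMul.algebraMap_injective Q ℂ)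
  -- Dupont's distribution identity in `𝒫(Q)`
  have key := PreBloch.distribution' hN hZ X
  -- lift the extended symbols to the free abelian group
  obtain ⟨s, hs, hs'⟩ := distrib_exists_symLift (Q := Q)
  set E : FreeAbelianGroup (PreBloch.Gen Q) :=
    s (X ^ N) - N • ∑ m ∈ Finset.range N, s (Z ^ m * X) with hEdef
  have hE : PreBloch.proj E = 0 := by
    rw [hEdef, map_sub, map_nsmul, map_sum]
    simp only [distrib_proj_symLift hs hs']
    rw [key, sub_self]
  have hEmem : E ∈ AddSubgroup.closure (fiveTermRelators Q) := (PreBloch.proj_eq_zero_iff E).1 hE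
  -- push forward to `ℤ[ℂ]`
  let ι : FreeAbelianGroup (PreBloch.Gen Q) →+ FreeAbelianGroup ℂ :=
    FreeAbelianGroup.lift fun g => of (g.val : ℂ)
  have hι : ∀ g, ι (of g) = of (g.val : ℂ) := fun g => lift_apply_of _ _
  have hιE : ι E ∈ AddSubgroup.closure dilogRelators :=
    closure_fiveTerm_le_comap (fun z hz => (hQ z).1 hz) ι hι hEmem
  -- compare with the target combination modulo the real relators `[0]`, `[1]`
  have hdiff : (of (x ^ N) - N • ∑ m ∈ Finset.range N, of (ζ ^ m * x)) - ι E ∈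
      AddSubgroup.closure dilogRelators := by
    have e1 : (of (x ^ N) - N • ∑ m ∈ Finset.range N, of (ζ ^ m * x)) - ι E =
        (of ((X ^ N : Q) : ℂ) - ι (s (X ^ N))) -
          N • ∑ m ∈ Finset.range N, (of ((Z ^ m * X : Q) : ℂ) - ι (s (Z ^ m * X))) := by
      rw [hEdef, map_sub, map_nsmul, map_sum, Finset.sum_sub_distrib, smul_sub]
      push_cast
      abel
    rw [e1]
    refine sub_mem (distrib_iota_symLift_sub_mem hs hs' ι hι _) (AddSubgroup.nsmul_mem _ ?_ _)
    exact AddSubgroup.sum_mem _ fun m _ => distrib_iota_symLift_sub_mem hs hs' ι hι _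
  have := add_mem hdiff hιE
  rwa [sub_add_cancel] at this

end Summit.KontsevichZagierPeriods.HyperbolicBloch.ZagierDilogarithmGaloisDescent

end
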